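import Summits.ABC.ABC.Theses.FeketeScales
import Summits.ABC.ABC.Theorems.FeketeScalesPolynomialAbcOfSubmult
import Summits.ABC.ABC.Theorems.FeketeScalesSparseGoodScalesWindow
import Summits.ABC.ABC.Theorems.FeketeScalesSparseGoodScalesMinimalResidue
import Literature.NumberTheory.DiophantineGeometry.AbcWave0SUnitProofs
import HarnessLib

/-!
# Route FeketeScales — crux `SparseGoodScales` (stmt-ABC-2161): the FIRST-MOMENT WALL and the
# domination of line `SketchIdeator1` by line `Sketch`

Helper file (`--supports stmt-ABC-2161`) for the crux `SparseGoodScales` of route `FeketeScales`,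
landing — def-free, in the tree's vocabulary (`IsABCTriple`, `rad`, the route decls) — the last
provable package of the crux chain that lived only in a workfile: round-1 ideator 1's
`Cruxes/SparseGoodScales/SketchIdeator1.lean` (idea card `radical-lacunarity-split`), cited by
`Lines/Sketch-dead.md`, `Lines/SketchIdeator1-dead.md`, both triage reports and the strategist's
census (W-arguments "every first-moment argument proves ABC outright").  Notation (docstrings only):

* the `δ`-SHADOW of an abc triple `t = (a,b,c)` is `(log c − (1+δ)·log rad(abc))⁺`; up to the factor
  `1/(1+δ)` it is the log-length of the interval of radical scales `[rad, c^{1/(1+δ)})` that `t` spoils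
  for the crux at exponent `1+δ` ("shadow calculus", `BarrierNotes-r1-k1.md` B1);
* SGS = the crux; WGS = windowed good scales (`Theorems/FeketeScalesSparseGoodScalesWindow.lean`);
  DA / DA∃ = droughts of every / some ratio (`Theorems/FeketeScalesSparseGoodScalesMinimalResidue.lean`);
  RL = ideator 1's `RadicalLacunarity`: `∀ δ > 0, ∀ l ∈ (0,1), ∀ N, ∃ Y ≥ N`, no abc triple of quality
  `> 1+δ` has its radical in the window `(Y^l, Y]`;
  BQ = bounded quality `∃ A C, ∀ abc, c ≤ C·rad^A` (= item stmt-ABC-1724 `PolynomialABC`).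

Results.
* §1 FIRST-MOMENT WALL, graded and as an equivalence:
  `abcAt_of_eventually_shadow_lt` (if the `δ`-shadows are eventually — along the cofinite filter on
  abc triples — below a constant, then abc holds AT exponent `1+δ`), `abcAt_of_summable_shadow`
  (summable `δ`-shadows ⟹ abc at exponent `1+δ`), `summable_shadow_of_abcAt` (abc at exponent `1+δ` ⟹
  the `δ'`-shadows have finite support for every `δ' > δ`, by abc.S25 — PROVED in the tree — hence are
  summable), `abc_iff_summable_shadows` (**ABC ↔ for every `δ > 0` the `δ`-shadows are summable**),
  and the corollaries `abc_of_summable_shadows` (ideator 1's wall) and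
  `sparseGoodScales_of_summable_shadows`.  Reading: the union bound "total log-measure of the
  `δ`-shadows is finite, so they cannot cover a tail of scales, so good scales exist infinitely often"
  is a valid proof scheme for SGS (and for WGS, DA, DA∃) whose HYPOTHESIS is already abc at exponent
  `1+δ`; no exceptional-set-counting / first-moment proof of any horizontal stub of this crux can be
  cheaper than the summit (`BarrierNotes-r1-k1.md` B2/B8, `BarrierNotes-r1-k2.md` N3, census W2/S5).
* §2 DOMINATION (`Lines/SketchIdeator1-dead.md`, kernel-checked): `windowed_of_radicalLacunarity`
  (RL ⟹ WGS), `droughtsOfEveryRatio_of_radicalLacunarity` / `radicalLacunarity_of_droughtsOfEveryRatio`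
  / `radicalLacunarity_iff_droughtsOfEveryRatio` (RL ↔ DA: ideator 1's horizontal stub IS the
  strategist's `DA`, window exponent `l = 1/Λ`), `droughtsOfSomeRatio_of_radicalLacunarity` (RL ⟹ DA∃),
  and line `SketchIdeator1`'s composition in tree vocabulary,
  `sparseGoodScales_of_boundedQuality_of_radicalLacunarity : BQ → RL → SGS`, obtained from line
  `Sketch`'s landed composition — so `SketchIdeator1` = `Sketch` with a stronger horizontal stub.

Nothing here proves any stub: RL, DA, WGS, DA∃ and BQ are open (RL/DA/WGS/DA∃ engine-less, BQ beyond
every Baker-type bound), and the crux carries the Wieferich floor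
(`Summit.ABC.ABC.Theorems.sparseGoodScales_imp_infinite_not_isWieferich`, p99695).
-/

-- `Summit.<Summit>.<Problem>` is the mandated summit-side namespace (CONVENTIONS §2); for the
-- single-conjunct summit `ABC` the two coincide, so the duplicate `ABC.ABC` is deliberate.
set_option linter.dupNamespace false

namespace Summit.ABC.ABC.Theorems.SparseGoodScales

open Literature.NumberTheory.DiophantineGeometry
open Summit.ABC.ABC.Theses.FeketeScales
open Summit.ABC.ABC.Theorems

/-! ## §0 Two positivity facts -/

/-- The radical of `abc` is a positive real (it is `≥ 1` in `ℕ`). [folklore] -/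
theorem firstMoment_rad_cast_pos (a b c : ℕ) : (0 : ℝ) < ((rad a b c : ℕ) : ℝ) := by
  have h : 1 ≤ rad a b c := by
    rw [rad_def]
    exact Nat.radical_pos _
  exact_mod_cast h

/-- The largest member `c = a + b` of an abc triple is a positive real. [folklore] -/
theorem firstMoment_c_cast_pos {a b c : ℕ} (h : IsABCTriple a b c) : (0 : ℝ) < (c : ℝ) := by
  have h1 : 0 < a := h.1
  have h3 : a + b = c := h.2.2.1
  have : 0 < c := by omega
  exact_mod_cast this

/-! ## §1 The first-moment wall -/

/-- **First-moment wall, eventual form.**  If along the cofinite filter on abc triples the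
`δ`-shadow `log c − (1+δ)·log rad` is eventually below a constant `B` (i.e. all but finitely many abc
triples have `c < e^B · rad^{1+δ}`), then abc holds AT exponent `1+δ`:
`∃ C > 0, ∀ abc, c < C · rad^{1+δ}`.  Proof: take `C := e^B + Σ_{exceptions} c_t / rad_t^{1+δ}`.
[folklore] -/
theorem abcAt_of_eventually_shadow_lt {δ B : ℝ}
    (h : ∀ᶠ t : {t : ℕ × ℕ × ℕ // IsABCTriple t.1 t.2.1 t.2.2} in Filter.cofinite,
      Real.log ((t.1.2.2 : ℕ) : ℝ) - (1 + δ) * Real.log ((rad t.1.1 t.1.2.1 t.1.2.2 : ℕ) : ℝ) < B) :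
    ∃ C : ℝ, 0 < C ∧ ∀ a b c : ℕ, IsABCTriple a b c →
      (c : ℝ) < C * ((rad a b c : ℕ) : ℝ) ^ (1 + δ) := by
  classical
  rw [Filter.eventually_cofinite] at h
  -- the finitely many exceptional triples and their quotients `c / rad^{1+δ}`
  let S := h.toFinset
  let Q : {t : ℕ × ℕ × ℕ // IsABCTriple t.1 t.2.1 t.2.2} → ℝ := fun t =>
    ((t.1.2.2 : ℕ) : ℝ) / ((rad t.1.1 t.1.2.1 t.1.2.2 : ℕ) : ℝ) ^ (1 + δ)
  have hQnn : ∀ t, 0 ≤ Q t := fun t =>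
    div_nonneg (Nat.cast_nonneg _) (Real.rpow_nonneg (Nat.cast_nonneg _) _)
  have hsum0 : 0 ≤ ∑ t ∈ S, Q t := Finset.sum_nonneg fun t _ => hQnn t
  refine ⟨Real.exp B + ∑ t ∈ S, Q t, by positivity, ?_⟩
  intro a b c habc
  have hrpos : (0 : ℝ) < ((rad a b c : ℕ) : ℝ) := firstMoment_rad_cast_pos a b c
  have hRpos : (0 : ℝ) < ((rad a b c : ℕ) : ℝ) ^ (1 + δ) := Real.rpow_pos_of_pos hrpos _
  have hcpos : (0 : ℝ) < (c : ℝ) := firstMoment_c_cast_pos habc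
  by_cases hmem : (⟨(a, b, c), habc⟩ : {t : ℕ × ℕ × ℕ // IsABCTriple t.1 t.2.1 t.2.2}) ∈ S
  · -- exceptional triple: its own quotient is one of the summands
    have hle : (c : ℝ) / ((rad a b c : ℕ) : ℝ) ^ (1 + δ) ≤ ∑ t ∈ S, Q t :=
      Finset.single_le_sum (f := Q) (fun t _ => hQnn t) hmem
    have hQt : (c : ℝ) / ((rad a b c : ℕ) : ℝ) ^ (1 + δ) * ((rad a b c : ℕ) : ℝ) ^ (1 + δ) = c :=
      div_mul_cancel₀ _ hRpos.ne'
    calc (c : ℝ) = (c : ℝ) / ((rad a b c : ℕ) : ℝ) ^ (1 + δ) * ((rad a b c : ℕ) : ℝ) ^ (1 + δ) :=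
          hQt.symm
      _ < (Real.exp B + ∑ t ∈ S, Q t) * ((rad a b c : ℕ) : ℝ) ^ (1 + δ) := by
          apply mul_lt_mul_of_pos_right _ hRpos
          linarith [Real.exp_pos B]
  · -- generic triple: `log c - (1+δ)·log rad < B`, i.e. `c < e^B · rad^{1+δ}`
    have hlt : Real.log (c : ℝ) - (1 + δ) * Real.log ((rad a b c : ℕ) : ℝ) < B := by
      by_contra hn
      exact hmem (h.mem_toFinset.mpr hn)
    have hc : (c : ℝ) < Real.exp B * ((rad a b c : ℕ) : ℝ) ^ (1 + δ) := by
      have hlog : Real.log (c : ℝ) < B + Real.log ((rad a b c : ℕ) : ℝ) * (1 + δ) := by linarith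
      calc (c : ℝ) = Real.exp (Real.log (c : ℝ)) := (Real.exp_log hcpos).symm
        _ < Real.exp (B + Real.log ((rad a b c : ℕ) : ℝ) * (1 + δ)) := Real.exp_lt_exp.mpr hlog
        _ = Real.exp B * ((rad a b c : ℕ) : ℝ) ^ (1 + δ) := by
            rw [Real.exp_add, Real.rpow_def_of_pos hrpos]
    calc (c : ℝ) < Real.exp B * ((rad a b c : ℕ) : ℝ) ^ (1 + δ) := hc
      _ ≤ (Real.exp B + ∑ t ∈ S, Q t) * ((rad a b c : ℕ) : ℝ) ^ (1 + δ) :=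
          mul_le_mul_of_nonneg_right (by linarith) hRpos.le

/-- **First-moment wall, graded form.**  If the `δ`-shadows `(log c − (1+δ)·log rad)⁺` are summable
over all abc triples (in particular if their total — the log-measure of the union of the `δ`-shadow
intervals, up to the factor `1/(1+δ)` — is finite), then abc holds at exponent `1+δ`.  So a union
bound over shadows never proves anything cheaper than abc itself at the same exponent. [folklore] -/
theorem abcAt_of_summable_shadow {δ : ℝ}
    (h : Summable (fun t : {t : ℕ × ℕ × ℕ // IsABCTriple t.1 t.2.1 t.2.2} =>
      max 0 (Real.log ((t.1.2.2 : ℕ) : ℝ) - (1 + δ) * Real.log ((rad t.1.1 t.1.2.1 t.1.2.2 : ℕ) : ℝ)))) :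
    ∃ C : ℝ, 0 < C ∧ ∀ a b c : ℕ, IsABCTriple a b c →
      (c : ℝ) < C * ((rad a b c : ℕ) : ℝ) ^ (1 + δ) :=
  abcAt_of_eventually_shadow_lt (B := 1) <|
    (h.tendsto_cofinite_zero.eventually_lt_const one_pos).mono fun _ ht =>
      lt_of_le_of_lt (le_max_right _ _) ht

/-- **Finitely many abc triples below any radical bound**, cofinite form of abc.S25
(`finite_setOf_isABCTriple_primeFactors_subset_holds`, Mahler 1933 — PROVED in the tree): along the
cofinite filter on abc triples the radical tends to infinity. [folklore] -/
theorem eventually_cofinite_lt_rad (X : ℕ) :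
    ∀ᶠ t : {t : ℕ × ℕ × ℕ // IsABCTriple t.1 t.2.1 t.2.2} in Filter.cofinite,
      X < rad t.1.1 t.1.2.1 t.1.2.2 := by
  rw [Filter.eventually_cofinite]
  have hfin := finite_setOf_isABCTriple_primeFactors_subset_holds (Finset.range (X + 1))
  refine (hfin.preimage Subtype.val_injective.injOn).subset ?_
  intro t ht
  simp only [Set.mem_setOf_eq, not_lt] at ht
  exact ⟨t.2, feketeScales_primeFactors_subset_range_of_rad_le ht⟩

/-- **Converse of the wall.**  abc at exponent `1+δ` makes the `δ'`-shadow VANISH for all but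
finitely many abc triples, for every `δ' > δ` (beyond radical `C^{1/(δ'−δ)}`; finitely many triples
lie below, by abc.S25), so the `δ'`-shadows are summable. [folklore] -/
theorem summable_shadow_of_abcAt {δ δ' : ℝ} (hlt : δ < δ')
    (h : ∃ C : ℝ, 0 < C ∧ ∀ a b c : ℕ, IsABCTriple a b c →
      (c : ℝ) < C * ((rad a b c : ℕ) : ℝ) ^ (1 + δ)) :
    Summable (fun t : {t : ℕ × ℕ × ℕ // IsABCTriple t.1 t.2.1 t.2.2} =>
      max 0 (Real.log ((t.1.2.2 : ℕ) : ℝ) - (1 + δ') * Real.log ((rad t.1.1 t.1.2.1 t.1.2.2 : ℕ) : ℝ))) := by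
  classical
  obtain ⟨C, hC, hABC⟩ := h
  have hd : 0 < δ' - δ := by linarith
  obtain ⟨X, hX⟩ := exists_nat_ge (C ^ (1 / (δ' - δ)))
  have hfin := eventually_cofinite_lt_rad X
  rw [Filter.eventually_cofinite] at hfin
  refine summable_of_ne_finset_zero (s := hfin.toFinset) ?_
  intro t ht
  rw [Set.Finite.mem_toFinset, Set.mem_setOf_eq, not_not] at ht
  -- `ht : X < rad`, so `C^{1/(δ'-δ)} < rad`, i.e. `log C < (δ'-δ)·log rad`
  show max 0 (Real.log ((t.1.2.2 : ℕ) : ℝ) -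
    (1 + δ') * Real.log ((rad t.1.1 t.1.2.1 t.1.2.2 : ℕ) : ℝ)) = 0
  have hrpos : (0 : ℝ) < ((rad t.1.1 t.1.2.1 t.1.2.2 : ℕ) : ℝ) :=
    firstMoment_rad_cast_pos _ _ _
  have hcpos : (0 : ℝ) < ((t.1.2.2 : ℕ) : ℝ) := firstMoment_c_cast_pos t.2
  have hc := hABC t.1.1 t.1.2.1 t.1.2.2 t.2
  have hlogc : Real.log ((t.1.2.2 : ℕ) : ℝ) <
      Real.log C + (1 + δ) * Real.log ((rad t.1.1 t.1.2.1 t.1.2.2 : ℕ) : ℝ) := by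
    have h1 := Real.log_lt_log hcpos hc
    rwa [Real.log_mul hC.ne' (Real.rpow_pos_of_pos hrpos _).ne', Real.log_rpow hrpos] at h1
  have hClog : Real.log C < (δ' - δ) * Real.log ((rad t.1.1 t.1.2.1 t.1.2.2 : ℕ) : ℝ) := by
    have h1 : C ^ (1 / (δ' - δ)) < ((rad t.1.1 t.1.2.1 t.1.2.2 : ℕ) : ℝ) :=
      lt_of_le_of_lt hX (by exact_mod_cast ht)
    have h2 := Real.log_lt_log (Real.rpow_pos_of_pos hC _) h1
    rw [Real.log_rpow hC] at h2
    have h3 := mul_lt_mul_of_pos_left h2 hd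
    rwa [← mul_assoc, mul_one_div_cancel hd.ne', one_mul] at h3
  apply max_eq_left
  nlinarith

/-- **THE FIRST-MOMENT WALL as an equivalence: `ABC ↔` the `δ`-shadows are summable for every
`δ > 0`.**  (`→`: abc at `δ/2` kills the `δ`-shadows off a finite set; `←`: graded wall.)  Hence
"summable shadows" — the hypothesis of every union-bound / exceptional-set-measure proof that the
shadows fail to cover a tail of scales — is not an intermediate statement but the summit itself.
[folklore] -/
theorem abc_iff_summable_shadows :
    _root_.ABC ↔ ∀ δ : ℝ, 0 < δ →
      Summable (fun t : {t : ℕ × ℕ × ℕ // IsABCTriple t.1 t.2.1 t.2.2} =>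
        max 0 (Real.log ((t.1.2.2 : ℕ) : ℝ) - (1 + δ) * Real.log ((rad t.1.1 t.1.2.1 t.1.2.2 : ℕ) : ℝ))) :=
  ⟨fun habc δ hδ => summable_shadow_of_abcAt (half_lt_self hδ)
      ((_root_.ABC_iff.mp habc) (δ / 2) (half_pos hδ)),
    fun h => _root_.ABC_iff.mpr fun ε hε => abcAt_of_summable_shadow (h ε hε)⟩

/-- **The first-moment wall, registered form** (the sub-goal of stmt-ABC-2161 this file serves, on
one line: it is the signature registered on the item).  This is `abc_iff_summable_shadows`.
[folklore] -/
theorem sparseGoodScales_abc_iff_summable_shadows : _root_.ABC ↔ ∀ δ : ℝ, 0 < δ → Summable (fun t : {t : ℕ × ℕ × ℕ // IsABCTriple t.1 t.2.1 t.2.2} => max 0 (Real.log ((t.1.2.2 : ℕ) : ℝ) - (1 + δ) * Real.log ((rad t.1.1 t.1.2.1 t.1.2.2 : ℕ) : ℝ))) :=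
  abc_iff_summable_shadows

/-- **Ideator 1's first-moment wall** (`Cruxes/SparseGoodScales/SketchIdeator1.lean`,
`abc_of_summable_shadows`, restated over the tree's `ABC`): summable `δ`-shadows for every `δ > 0`
already give the abc conjecture. [folklore] -/
theorem abc_of_summable_shadows
    (h : ∀ δ : ℝ, 0 < δ →
      Summable (fun t : {t : ℕ × ℕ × ℕ // IsABCTriple t.1 t.2.1 t.2.2} =>
        max 0 (Real.log ((t.1.2.2 : ℕ) : ℝ) - (1 + δ) * Real.log ((rad t.1.1 t.1.2.1 t.1.2.2 : ℕ) : ℝ)))) :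
    _root_.ABC :=
  abc_iff_summable_shadows.mpr h

/-- **The wall, read at the crux**: the union-bound route to `SparseGoodScales` (summable shadows ⟹
the shadows cannot cover a tail ⟹ good scales infinitely often) factors through the summit —
its hypothesis gives `ABC`, whence the crux by the landed calibration `sparseGoodScales_of_abc`.
[folklore] -/
theorem sparseGoodScales_of_summable_shadows
    (h : ∀ δ : ℝ, 0 < δ →
      Summable (fun t : {t : ℕ × ℕ × ℕ // IsABCTriple t.1 t.2.1 t.2.2} =>
        max 0 (Real.log ((t.1.2.2 : ℕ) : ℝ) - (1 + δ) * Real.log ((rad t.1.1 t.1.2.1 t.1.2.2 : ℕ) : ℝ)))) :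
    SparseGoodScales :=
  sparseGoodScales_of_abc (abc_of_summable_shadows h)

/-! ## §2 Line `SketchIdeator1` is line `Sketch` with a stronger horizontal stub -/

/-- **RL ⟹ DA** (radical lacunarity gives droughts of EVERY ratio): with window exponent
`l := 1/Λ ∈ (0,1)`, a triple with `rad ≤ R < rad^Λ` has `R^{1/Λ} < rad`, so it lies in ideator 1's
window `(R^l, R]` and has quality `≤ 1+δ`. [folklore] -/
theorem droughtsOfEveryRatio_of_radicalLacunarity
    (hL : ∀ δ : ℝ, 0 < δ → ∀ l : ℝ, 0 < l → l < 1 → ∀ N : ℕ, ∃ Y : ℕ, N ≤ Y ∧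
      ∀ a b c : ℕ, IsABCTriple a b c → (Y : ℝ) ^ l < ((rad a b c : ℕ) : ℝ) → rad a b c ≤ Y →
        (c : ℝ) ≤ ((rad a b c : ℕ) : ℝ) ^ (1 + δ)) :
    ∀ δ : ℝ, 0 < δ → ∀ Λ : ℝ, 1 < Λ → ∀ N : ℕ, ∃ R : ℕ, N ≤ R ∧ ∀ a b c : ℕ,
      IsABCTriple a b c → rad a b c ≤ R → (R : ℝ) < ((rad a b c : ℕ) : ℝ) ^ Λ →
        (c : ℝ) ≤ ((rad a b c : ℕ) : ℝ) ^ (1 + δ) := by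
  intro δ hδ Λ hΛ N
  have hΛpos : 0 < Λ := by linarith
  have hl0 : 0 < 1 / Λ := by positivity
  have hl1 : 1 / Λ < 1 := by rw [div_lt_one hΛpos]; exact hΛ
  obtain ⟨Y, hYN, hY⟩ := hL δ hδ (1 / Λ) hl0 hl1 N
  refine ⟨Y, hYN, fun a b c habc hr hwin => hY a b c habc ?_ hr⟩
  -- `Y^{1/Λ} < (rad^Λ)^{1/Λ} = rad`
  have hr0 : (0 : ℝ) ≤ ((rad a b c : ℕ) : ℝ) := Nat.cast_nonneg _
  have h1 : (Y : ℝ) ^ (1 / Λ) < (((rad a b c : ℕ) : ℝ) ^ Λ) ^ (1 / Λ) :=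
    Real.rpow_lt_rpow (Nat.cast_nonneg _) hwin hl0
  rwa [← Real.rpow_mul hr0, mul_one_div_cancel hΛpos.ne', Real.rpow_one] at h1

/-- **DA ⟹ RL** (the converse: with `Λ := 1/l > 1`, a triple with `Y^l < rad ≤ Y` has
`Y < rad^{1/l}`), so ideator 1's horizontal stub and the strategist's `DA` coincide. [folklore] -/
theorem radicalLacunarity_of_droughtsOfEveryRatio
    (hD : ∀ δ : ℝ, 0 < δ → ∀ Λ : ℝ, 1 < Λ → ∀ N : ℕ, ∃ R : ℕ, N ≤ R ∧ ∀ a b c : ℕ,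
      IsABCTriple a b c → rad a b c ≤ R → (R : ℝ) < ((rad a b c : ℕ) : ℝ) ^ Λ →
        (c : ℝ) ≤ ((rad a b c : ℕ) : ℝ) ^ (1 + δ)) :
    ∀ δ : ℝ, 0 < δ → ∀ l : ℝ, 0 < l → l < 1 → ∀ N : ℕ, ∃ Y : ℕ, N ≤ Y ∧
      ∀ a b c : ℕ, IsABCTriple a b c → (Y : ℝ) ^ l < ((rad a b c : ℕ) : ℝ) → rad a b c ≤ Y →
        (c : ℝ) ≤ ((rad a b c : ℕ) : ℝ) ^ (1 + δ) := by
  intro δ hδ l hl0 hl1 N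
  have hΛ : 1 < 1 / l := by rw [lt_div_iff₀ hl0]; linarith
  obtain ⟨R, hRN, hR⟩ := hD δ hδ (1 / l) hΛ N
  refine ⟨R, hRN, fun a b c habc hwin hr => hR a b c habc hr ?_⟩
  -- `R = (R^l)^{1/l} < rad^{1/l}`
  have hR0 : (0 : ℝ) ≤ (R : ℝ) := Nat.cast_nonneg _
  have h1 : ((R : ℝ) ^ l) ^ (1 / l) < ((rad a b c : ℕ) : ℝ) ^ (1 / l) :=
    Real.rpow_lt_rpow (Real.rpow_nonneg hR0 _) hwin (by positivity)
  rwa [← Real.rpow_mul hR0, mul_one_div_cancel hl0.ne', Real.rpow_one] at h1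

/-- **RL ↔ DA**: ideator 1's `RadicalLacunarity` is exactly "droughts of every ratio". [folklore] -/
theorem radicalLacunarity_iff_droughtsOfEveryRatio :
    (∀ δ : ℝ, 0 < δ → ∀ l : ℝ, 0 < l → l < 1 → ∀ N : ℕ, ∃ Y : ℕ, N ≤ Y ∧
      ∀ a b c : ℕ, IsABCTriple a b c → (Y : ℝ) ^ l < ((rad a b c : ℕ) : ℝ) → rad a b c ≤ Y →
        (c : ℝ) ≤ ((rad a b c : ℕ) : ℝ) ^ (1 + δ)) ↔
    (∀ δ : ℝ, 0 < δ → ∀ Λ : ℝ, 1 < Λ → ∀ N : ℕ, ∃ R : ℕ, N ≤ R ∧ ∀ a b c : ℕ,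
      IsABCTriple a b c → rad a b c ≤ R → (R : ℝ) < ((rad a b c : ℕ) : ℝ) ^ Λ →
        (c : ℝ) ≤ ((rad a b c : ℕ) : ℝ) ^ (1 + δ)) :=
  ⟨droughtsOfEveryRatio_of_radicalLacunarity, radicalLacunarity_of_droughtsOfEveryRatio⟩

/-- **RL ⟹ WGS** (the domination recorded in `Lines/SketchIdeator1-dead.md`): inside a drought
window a triple has `c ≤ rad^{1+δ} ≤ R^{1+δ}`.  So ideator 1's horizontal stub implies line `Sketch`'s
`stub_windowedGoodScales`, with the same absence of any engine. [folklore] -/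
theorem windowed_of_radicalLacunarity
    (hL : ∀ δ : ℝ, 0 < δ → ∀ l : ℝ, 0 < l → l < 1 → ∀ N : ℕ, ∃ Y : ℕ, N ≤ Y ∧
      ∀ a b c : ℕ, IsABCTriple a b c → (Y : ℝ) ^ l < ((rad a b c : ℕ) : ℝ) → rad a b c ≤ Y →
        (c : ℝ) ≤ ((rad a b c : ℕ) : ℝ) ^ (1 + δ)) :
    ∀ δ : ℝ, 0 < δ → ∀ Λ : ℝ, 1 < Λ → ∀ N : ℕ, ∃ R : ℕ, N ≤ R ∧ ∀ a b c : ℕ, IsABCTriple a b c →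
      rad a b c ≤ R → (R : ℝ) < ((rad a b c : ℕ) : ℝ) ^ Λ → (c : ℝ) ≤ (R : ℝ) ^ (1 + δ) := by
  intro δ hδ Λ hΛ N
  obtain ⟨R, hRN, hR⟩ := droughtsOfEveryRatio_of_radicalLacunarity hL δ hδ Λ hΛ N
  refine ⟨R, hRN, fun a b c habc hr hwin => (hR a b c habc hr hwin).trans ?_⟩
  exact Real.rpow_le_rpow (Nat.cast_nonneg _) (by exact_mod_cast hr) (by linarith)

/-- **RL ⟹ DA∃**: ideator 1's horizontal stub implies the minimal residue of line `SketchIdeator4`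
(through DA, `droughtsOfSomeRatio_of_every`). [folklore] -/
theorem droughtsOfSomeRatio_of_radicalLacunarity
    (hL : ∀ δ : ℝ, 0 < δ → ∀ l : ℝ, 0 < l → l < 1 → ∀ N : ℕ, ∃ Y : ℕ, N ≤ Y ∧
      ∀ a b c : ℕ, IsABCTriple a b c → (Y : ℝ) ^ l < ((rad a b c : ℕ) : ℝ) → rad a b c ≤ Y →
        (c : ℝ) ≤ ((rad a b c : ℕ) : ℝ) ^ (1 + δ)) :
    ∀ δ : ℝ, 0 < δ → ∃ Λ : ℝ, 1 < Λ ∧ ∀ N : ℕ, ∃ R : ℕ, N ≤ R ∧ ∀ a b c : ℕ,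
      IsABCTriple a b c → rad a b c ≤ R → (R : ℝ) < ((rad a b c : ℕ) : ℝ) ^ Λ →
        (c : ℝ) ≤ ((rad a b c : ℕ) : ℝ) ^ (1 + δ) :=
  droughtsOfSomeRatio_of_every (droughtsOfEveryRatio_of_radicalLacunarity hL)

/-- **Line `SketchIdeator1`'s composition in the tree's vocabulary** (`PolyABC → RadicalLacunarity →
SparseGoodScales` of `Cruxes/SparseGoodScales/SketchIdeator1.lean`): bounded quality and radical
lacunarity give the crux — via line `Sketch`'s landed composition
`sparseGoodScales_of_boundedQuality_of_windowed` (p96117) and the domination RL ⟹ WGS.  Both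
hypotheses are open (BQ = item stmt-ABC-1724; RL engine-less), which is why the line is a dead file.
[folklore] -/
theorem sparseGoodScales_of_boundedQuality_of_radicalLacunarity
    (hB : ∃ A C : ℝ, ∀ a b c : ℕ, IsABCTriple a b c → (c : ℝ) ≤ C * ((rad a b c : ℕ) : ℝ) ^ A)
    (hL : ∀ δ : ℝ, 0 < δ → ∀ l : ℝ, 0 < l → l < 1 → ∀ N : ℕ, ∃ Y : ℕ, N ≤ Y ∧
      ∀ a b c : ℕ, IsABCTriple a b c → (Y : ℝ) ^ l < ((rad a b c : ℕ) : ℝ) → rad a b c ≤ Y →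
        (c : ℝ) ≤ ((rad a b c : ℕ) : ℝ) ^ (1 + δ)) :
    SparseGoodScales :=
  sparseGoodScales_of_boundedQuality_of_windowed hB (windowed_of_radicalLacunarity hL)

end Summit.ABC.ABC.Theorems.SparseGoodScales
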